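/-
Copyright (c) 2026 the pub-hodgecm-mathlib formalisation cell (harness21).  Prover seat hodgecm-mathlib-LH4-p04 (g2), req620 Track A «(D-RAM) FOUR-FRAME» squad
(unit U3_Laws, (KMS) road «MODULO κ-STAGE B», brick κB-T «T-STRATA κ-SOCKETS», FILE 1∕3: EVALUATION TOOLS (ω∕χ bookkeeping, explicit polarisations); dealer LH4-plan (g11) WORD #35 (2);
head letters F0P3a-p01 (g32) 2026-09-04T01:25:48Z (B); plan LH4-p05 (g3) `PLAN-KMS-modKappaStageB.v1` §4 row «on-branch»).  2026-09-04.
-/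
import Summits.HodgeConjecture.HodgeConjecture.Theorems.F0P3cDyRamDiagonalKappaCountEval       -- ★ Fκ2 (LH4-p05): `kappaCount_zero_eq_of_dichotomy`; brings ★ Fκ1 p856497 `KappaCountDefs` (`chiVec`, `kappaCount`), ★ `normSign_eq_one_or` (p855115), ★ `normSign_mul_norm` (p855032), ★ StrataDefs ED. 3, ★ TorusDefs, ★ `normSign`
import Summits.HodgeConjecture.HodgeConjecture.Theorems.F0P3cDyRamDiagonalSplitCountSockets    -- ★ B4 (LH4-p13): `M₃∕M₁∕M₂(s,·)`, `det_axisN_ne_zero`, `isNormalisedLattice_latt_axisN`, `mem_fixedUnitStabilizer_latt_axisN_iff`, `mapGL_diagonal_stdLattice_eq`; brings ★ StratumTools (Gram blocks), ★ `formCongr_hnf_diagonal`, ★ CoreUnique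
import Literature.NumberTheory.LocalFields.WildQuadraticDatumNonNormUnitLevel                     -- (this seat): `exists_fixed_unit_not_norm_of_level_pow`; brings ★ `exists_nonnorm_dichotomy_of_isRamifiedQuadraticDatum`, ★ deep norms `exists_mul_map_eq_of_isRamifiedQuadraticDatum`
import Literature.NumberTheory.LocalFields.WildQuadraticDatumNormSignConductor                    -- ★ (LH4-p06 (g3)): `normSign_eq_of_near` (the ALIVE engine: fixed units congruent at F-level ≥ d have the same ω), `isAdicComplete_valuedInteger_of_completeSpace`; brings ★ `normSign_one`, `normSign_of_not_isNorm`
import Literature.NumberTheory.Automorphic.UnitaryLatticeTreeTubeCoordinate                        -- ★ `v_pow_le_v_pow_iff`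
import HarnessLib

/-!
# Crux `H413`, line LH4 «(D-RAM) FOUR-FRAME» road — unit U3_Laws (iii), (KMS) road «MODULO κ-STAGE B», brick κB-T FILE 1∕3: EVALUATION TOOLS for the signed κ-count of the
# split (on-branch) lattices — `ω`∕`χ` bookkeeping and the explicit type-0 polarisations of `M₁∕M₂∕M₃(s,·)`

Cell `hodgecm-mathlib` (D-0151), FLOOR 0, crux item H413 = `stmt-HodgeConjecture-24833`, route of record `HCCMUnconditional`; squad F0∕P3c∕LH4 (req618∕req620); registered stub served:
`F0P3cDyRamFourFrameU3.stub_U3_kappaModelSum` (KMS; tree `Cruxes/H413/Lines/F0_P3c_DyRamFourFrame_U3_Laws.lean` ED. 7 :407–:429).  THEOREMS ONLY (no `def`, no instance, no notation,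
no `sorry`, default heartbeats); lane `--supports stmt-HodgeConjecture-24833 --as helper` (count-neutral).  FILE 2 `…DiagonalKappaSplitCountValues` evaluates the κ-count of
each split lattice with these tools; FILE 3 `…DiagonalKappaSplitCountSockets` sums them over the four T-strata of LH4-p05 (g3)'s κ-Stage-B table.

THE MATHEMATICS (PLAN v1 §4, row «on-branch»; Serre V §3 Cor. 3).  `ω = normSign σ` is the norm-residue sign of `F = K^σ`, `χ_i(u) = Π_{j ≠ i} ω(u_j)`, and by Fκ2
`kappaCount_zero_eq_of_dichotomy` the type-0 κ-count of a normalised lattice `M` with polarisation `D₁` is `χ_i(D₁)·[χ_i ≡ 1 on S_F(M)]`.  For the axis-1 on-branch lattice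
`M₁(s,z) = latt (1 0 0; 0 1 0; 0 z ϖ^s)` (`|z| = 1`, `s = 2j`; the plane `⟨e₁,e₂⟩` at distance `s`, `e₀` split off): `S_F(M₁) = {u ∈ 𝒰^σ : |u₂ − u₁| ≤ |ϖ^s|}` (★ B4), i.e.
`u₂∕u₁ ∈ U_F^{(s∕2)}`, and an explicit polarisation is `D₁ = (1, −zσz·π₀^{−j}, π₀^{−j})`, `π₀ = ϖσϖ = N(ϖ)` (★ B4, inside an `∃` — re-exported here).  Hence:
(ALIVE) for `s ≥ 2d` every `u ∈ S_F` has `ω(u₂) = ω(u₁)` (★ `normSign_eq_of_near`: deep fixed one-units are norms), so `χ_0(u) = ω(u₁)ω(u₂) = ω(u₁)² = 1`, and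
`κ_0(M₁) = χ_0(D₁) = ω(−N z·π₀^{−j})·ω(π₀^{−j}) = ω(−1)` (norm factors drop, ★ `normSign_mul_norm`); (DEAD FOOT) for `s < 2d` the fixed non-norm unit `u₀ ∈ U_F^{(s∕2)}` of
★ `exists_fixed_unit_not_norm_of_level_pow` gives `(1, 1, u₀) ∈ S_F` with `χ_0 = ω(u₀) = −1`, so `κ_0 = 0`; (DEAD OFF-FOOT) `(c, 1, 1) ∈ S_F` for the non-norm fixed unit `c` (★ NI2 exact)
has `χ_1 = χ_2 = ω(c) = −1`, so `κ_1 = κ_2 = 0`.  Axes 2 and 3 are the same computation with the slots permuted; on the root `𝒪³` (`S_F = 𝒰^σ`) every `χ_i` sees `c`, so `κ_i = 0`.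

WHAT IS PROVED (generic valued field).  §1 `ω`∕`χ` bookkeeping (`normSign_mul_self`, `chiVec_zero∕one∕two`, `normSign_normVarpi_pow_inv`, `normSign_neg_polarisation_entry`; the
ALIVE engine is ★ `normSign_eq_of_near` of LH4-p06 (g3)'s ω-conductor toolkit, `ω(1) = 1` and `ω(non-norm) = −1` are ★ `normSign_one` ∕ `normSign_of_not_isNorm`).  §2 the explicit
polarisations `isVertexLattice_latt_axis1∕2∕3`.
HONEST LABEL.  Count-neutral (`--supports`); nothing printed is asserted; (KMS) stays a PROVER TARGET (empirical census law in diagonal-model currency); `HC_CM` is proved only modulo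
the 7 printed citations (2 remaining named inputs: hLiu418 = `stmt-HodgeConjecture-24832`, h413 = `stmt-HodgeConjecture-24833`) until rung 0 closes.

## References
* [Kottwitz1986BaseChangeUnits] R. E. Kottwitz, *Base change for unit elements of Hecke algebras*, Compositio Math. 60 (1986), §1 pp. 240–241 (κ-orbital integrals of units as
  signed lattice counts modulo the torus).
* [Rogawski1990] J. D. Rogawski, *Automorphic Representations of Unitary Groups in Three Variables*, Ann. of Math. Stud. 123 (1990), §4.9 Prop. 4.9.1 (a) p. 55, §4.10 p. 58.
* [Serre1979] J.-P. Serre, *Local Fields*, GTM 67 (1979), Ch. V §3 Prop. 5, Cor. 3 (norms on the unit filtration; the conductor of a ramified quadratic extension).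
* [Jacobowitz1962] R. Jacobowitz, *Hermitian forms over local fields*, Amer. J. Math. 84 (1962), §4, §7 (Gram matrices, unimodular lattices).
-/

set_option autoImplicit false

noncomputable section

namespace Summit.HodgeConjecture.HodgeConjecture.Cruxes.H413.F0P3cDyRamDiagonalKappaSplitCountEval

open Matrix
open Literature.NumberTheory.Automorphic Literature.NumberTheory.Automorphic.HermitianLattice
open Literature.NumberTheory.Automorphic.UnitaryLatticeTree Literature.NumberTheory.Automorphic.UnitaryThreeFourFrame
open Literature.NumberTheory.LocalFields Literature.NumberTheory.LocalFields.WildQuadraticDatum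
open Summit.HodgeConjecture.HodgeConjecture.Cruxes.H413.F0P3cDyRamDiagonalTorusDefs
open Summit.HodgeConjecture.HodgeConjecture.Cruxes.H413.F0P3cDyRamDiagonalStrataDefs
open Summit.HodgeConjecture.HodgeConjecture.Cruxes.H413.F0P3cDyRamDiagonalKappaCountDefs
open Summit.HodgeConjecture.HodgeConjecture.Cruxes.H413.F0P3cDyRamDiagonalKappaCountEval
open Summit.HodgeConjecture.HodgeConjecture.Cruxes.H413.F0P3cDyRamStableSumSignClasses (normSign_eq_one_or)
open Summit.HodgeConjecture.HodgeConjecture.Cruxes.H413.F0P3cDyRamFixedCountDiagonalModel (normSign_mul_norm)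
open Summit.HodgeConjecture.HodgeConjecture.Cruxes.H413.F0P3cDyRamDiagonalStratumTools
open Summit.HodgeConjecture.HodgeConjecture.Cruxes.H413.F0P3cDyRamDiagonalGluedTubeCriterion (formCongr_hnf_diagonal)
open Summit.HodgeConjecture.HodgeConjecture.Cruxes.H413.F0P3cDyRamDiagonalCoreUnique
open Summit.HodgeConjecture.HodgeConjecture.Cruxes.H413.F0P3cDyRamDiagonalSplitCount
open Summit.HodgeConjecture.HodgeConjecture.Cruxes.H413.F0P3cDyRamDiagonalSplitCountAxisOne
open Summit.HodgeConjecture.HodgeConjecture.Cruxes.H413.F0P3cDyRamDiagonalSplitCountAxisTwo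
open Summit.HodgeConjecture.HodgeConjecture.Cruxes.H413.F0P3cDyRamDiagonalSplitCountSockets (mapGL_diagonal_stdLattice_eq)
open scoped Valued WithZero Matrix MatrixGroups

variable {K : Type} [Field K]

/-! ## §1  `ω` and `χ_i` bookkeeping -/

/-- `ω(x)² = 1`. [cite: Rogawski1990, §4.10 p. 58] -/
theorem normSign_mul_self (σ : K →+* K) (x : K) : normSign σ x * normSign σ x = 1 := by
  rcases normSign_eq_one_or σ x with h | h <;> rw [h] <;> norm_num

/-- `χ_0(D) = ω(D 1)·ω(D 2)` (`rfl`). [cite: Rogawski1990, §4.10 p. 58] -/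
theorem chiVec_zero (σ : K →+* K) (D : Fin 3 → K) : chiVec σ 0 D = normSign σ (D 1) * normSign σ (D 2) := rfl

/-- `χ_1(D) = ω(D 0)·ω(D 2)` (`rfl`). [cite: Rogawski1990, §4.10 p. 58] -/
theorem chiVec_one (σ : K →+* K) (D : Fin 3 → K) : chiVec σ 1 D = normSign σ (D 0) * normSign σ (D 2) := rfl

/-- `χ_2(D) = ω(D 0)·ω(D 1)` (`rfl`). [cite: Rogawski1990, §4.10 p. 58] -/
theorem chiVec_two (σ : K →+* K) (D : Fin 3 → K) : chiVec σ 2 D = normSign σ (D 0) * normSign σ (D 1) := rfl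

/-- **`ω(π₀^{−j}) = 1`**: `((ϖσϖ)^j)⁻¹ = N((ϖ^j)⁻¹)` is a norm. [cite: Serre1979, Ch. V §3] -/
theorem normSign_normVarpi_pow_inv {σ : K →+* K} {ϖ : K} (hϖ0 : ϖ ≠ 0) (j : ℕ) : normSign σ (((ϖ * σ ϖ) ^ j)⁻¹ : K) = 1 := by
  have hw0 : (ϖ ^ j)⁻¹ ≠ 0 := inv_ne_zero (pow_ne_zero _ hϖ0)
  have hN : (((ϖ * σ ϖ) ^ j)⁻¹ : K) = 1 * ((ϖ ^ j)⁻¹ * σ ((ϖ ^ j)⁻¹)) := by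
    rw [one_mul, map_inv₀, map_pow, ← mul_inv, ← mul_pow]
  rw [hN, normSign_mul_norm σ 1 hw0, normSign_one]

/-- **`ω(−σz·π₀^{−j}·z) = ω(−1)`** for `z ≠ 0`: the norm factors `zσz` and `π₀^{−j}` drop. [cite: Serre1979, Ch. V §3] -/
theorem normSign_neg_polarisation_entry {σ : K →+* K} {ϖ : K} (hϖ0 : ϖ ≠ 0) {z : K} (hz0 : z ≠ 0) (j : ℕ) :
    normSign σ (-(σ z * ((ϖ * σ ϖ) ^ j)⁻¹ * z)) = normSign σ (-1 : K) := by
  have hw0 : (ϖ ^ j)⁻¹ ≠ 0 := inv_ne_zero (pow_ne_zero _ hϖ0)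
  have h1 : -(σ z * ((ϖ * σ ϖ) ^ j)⁻¹ * z) = -((ϖ * σ ϖ) ^ j)⁻¹ * (z * σ z) := by ring
  have h2 : (-((ϖ * σ ϖ) ^ j)⁻¹ : K) = -1 * ((ϖ ^ j)⁻¹ * σ ((ϖ ^ j)⁻¹)) := by
    rw [map_inv₀, map_pow, ← mul_inv, ← mul_pow, neg_one_mul]
  rw [h1, normSign_mul_norm σ _ hz0, h2, normSign_mul_norm σ _ hw0]

section Valued

variable [Valued K ℤᵐ⁰]

/-! ## §2  The explicit type-0 polarisations of the split lattices (★ B4 proves them inside an `∃`; re-exported with the form named) -/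

/-- **AXIS 1 — EXPLICIT POLARISATION**: `M₁(2j, z)` is self-dual for `diag(1, −zσz·π₀^{−j}, π₀^{−j})` (★ B4 (T₁·a), Gram block `(1 0 0; 0 0 a; 0 b c)`).
[cite: Jacobowitz1962, §4, §7] [cite: Rogawski1990, §4.9 Prop. 4.9.1 (a) p. 55] -/
theorem isVertexLattice_latt_axis1 {σ : K →+* K} (hvσ : ∀ a, Valued.v (σ a) = Valued.v a)
    {ϖ : K} (hϖ : Valued.v ϖ = WithZero.exp (-1 : ℤ)) {z : K} (hz : Valued.v z = 1) (j : ℕ) :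
    IsVertexLattice σ ϖ (Matrix.diagonal ![1, -(σ z * ((ϖ * σ ϖ) ^ j)⁻¹ * z), ((ϖ * σ ϖ) ^ j)⁻¹]) 0
      (latt (!![1, 0, 0; 0, 1, 0; 0, z, ϖ ^ (2 * j)] : Matrix (Fin 3) (Fin 3) K)) := by
  have hϖ0 : ϖ ≠ 0 := fun h0 => by rw [h0, map_zero] at hϖ; exact WithZero.coe_ne_zero hϖ.symm
  have hϖ1 : Valued.v ϖ ≤ 1 := by rw [hϖ, ← WithZero.exp_zero, WithZero.exp_le_exp]; norm_num
  have hvϖ0 : Valued.v ϖ ≠ 0 := (Valuation.ne_zero_iff _).2 hϖ0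
  set d₁ : K := ((ϖ * σ ϖ) ^ j)⁻¹ with hd₁
  have hvd₁p : Valued.v d₁ * Valued.v (ϖ ^ (2 * j)) = 1 := by
    rw [hd₁, map_inv₀, map_pow, map_mul, hvσ, ← sq, map_pow, ← pow_mul]
    exact inv_mul_cancel₀ (pow_ne_zero _ hvϖ0)
  have hG : formCongr σ (Matrix.GeneralLinearGroup.mkOfDetNeZero _ (det_axis1_ne_zero hϖ0 z (2 * j))) (Matrix.diagonal ![1, -(σ z * d₁ * z), d₁]) =
      !![1, 0, 0; 0, 0, σ z * d₁ * ϖ ^ (2 * j); 0, σ (ϖ ^ (2 * j)) * d₁ * z, σ (ϖ ^ (2 * j)) * d₁ * ϖ ^ (2 * j)] := by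
    rw [formCongr_hnf_diagonal σ _ 0 0 z 1 (ϖ ^ (2 * j)) _ rfl]
    ext i k
    fin_cases i <;> fin_cases k <;> simp
  refine isVertexLattice_zero_of_gram_eq_block₁ hϖ1 _ hG ?_ ?_ ?_ (map_one _)
  · rw [map_mul, map_mul, hvσ, hz, one_mul, hvd₁p]
  · rw [map_mul, map_mul, hvσ, hz, mul_one, mul_comm, hvd₁p]
  · rw [map_mul, map_mul, hvσ, mul_comm (Valued.v (ϖ ^ (2 * j))) (Valued.v d₁), mul_assoc, mul_comm (Valued.v (ϖ ^ (2 * j))),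
      ← mul_assoc, hvd₁p, one_mul, map_pow]
    exact pow_le_one' hϖ1 _

/-- **AXIS 2 — EXPLICIT POLARISATION**: `M₂(2j, y)` is self-dual for `diag(−yσy·π₀^{−j}, 1, π₀^{−j})` (★ B4 (T₂·a), Gram block `(0 0 a; 0 1 0; b 0 c)`).
[cite: Jacobowitz1962, §4, §7] [cite: Rogawski1990, §4.9 Prop. 4.9.1 (a) p. 55] -/
theorem isVertexLattice_latt_axis2 {σ : K →+* K} (hvσ : ∀ a, Valued.v (σ a) = Valued.v a)
    {ϖ : K} (hϖ : Valued.v ϖ = WithZero.exp (-1 : ℤ)) {y : K} (hy : Valued.v y = 1) (j : ℕ) :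
    IsVertexLattice σ ϖ (Matrix.diagonal ![-(σ y * ((ϖ * σ ϖ) ^ j)⁻¹ * y), 1, ((ϖ * σ ϖ) ^ j)⁻¹]) 0
      (latt (!![1, 0, 0; 0, 1, 0; y, 0, ϖ ^ (2 * j)] : Matrix (Fin 3) (Fin 3) K)) := by
  have hϖ0 : ϖ ≠ 0 := fun h0 => by rw [h0, map_zero] at hϖ; exact WithZero.coe_ne_zero hϖ.symm
  have hϖ1 : Valued.v ϖ ≤ 1 := by rw [hϖ, ← WithZero.exp_zero, WithZero.exp_le_exp]; norm_num
  have hvϖ0 : Valued.v ϖ ≠ 0 := (Valuation.ne_zero_iff _).2 hϖ0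
  set d₁ : K := ((ϖ * σ ϖ) ^ j)⁻¹ with hd₁
  have hvd₁p : Valued.v d₁ * Valued.v (ϖ ^ (2 * j)) = 1 := by
    rw [hd₁, map_inv₀, map_pow, map_mul, hvσ, ← sq, map_pow, ← pow_mul]
    exact inv_mul_cancel₀ (pow_ne_zero _ hvϖ0)
  have hG : formCongr σ (Matrix.GeneralLinearGroup.mkOfDetNeZero _ (det_axis2_ne_zero hϖ0 y (2 * j))) (Matrix.diagonal ![-(σ y * d₁ * y), 1, d₁]) =
      !![0, 0, σ y * d₁ * ϖ ^ (2 * j); 0, 1, 0; σ (ϖ ^ (2 * j)) * d₁ * y, 0, σ (ϖ ^ (2 * j)) * d₁ * ϖ ^ (2 * j)] := by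
    rw [formCongr_hnf_diagonal σ _ 0 y 0 1 (ϖ ^ (2 * j)) _ rfl]
    ext i k
    fin_cases i <;> fin_cases k <;> simp
  refine isVertexLattice_zero_of_gram_eq_block₂ hϖ1 _ hG ?_ ?_ ?_ (map_one _)
  · rw [map_mul, map_mul, hvσ, hy, one_mul, hvd₁p]
  · rw [map_mul, map_mul, hvσ, hy, mul_one, mul_comm, hvd₁p]
  · rw [map_mul, map_mul, hvσ, mul_comm (Valued.v (ϖ ^ (2 * j))) (Valued.v d₁), mul_assoc, mul_comm (Valued.v (ϖ ^ (2 * j))),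
      ← mul_assoc, hvd₁p, one_mul, map_pow]
    exact pow_le_one' hϖ1 _

/-- **AXIS 3 — EXPLICIT POLARISATION**: `M₃(2j, x)` is self-dual for `diag(−xσx·π₀^{−j}, π₀^{−j}, 1)` (★ B4 (T₃·a), Gram block `(0 a 0; b c 0; 0 0 1)`).
[cite: Jacobowitz1962, §4, §7] [cite: Rogawski1990, §4.9 Prop. 4.9.1 (a) p. 55] -/
theorem isVertexLattice_latt_axis3 {σ : K →+* K} (hvσ : ∀ a, Valued.v (σ a) = Valued.v a)
    {ϖ : K} (hϖ : Valued.v ϖ = WithZero.exp (-1 : ℤ)) {x : K} (hx : Valued.v x = 1) (j : ℕ) :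
    IsVertexLattice σ ϖ (Matrix.diagonal ![-(σ x * ((ϖ * σ ϖ) ^ j)⁻¹ * x), ((ϖ * σ ϖ) ^ j)⁻¹, 1]) 0
      (latt (!![1, 0, 0; x, ϖ ^ (2 * j), 0; 0, 0, 1] : Matrix (Fin 3) (Fin 3) K)) := by
  have hϖ0 : ϖ ≠ 0 := fun h0 => by rw [h0, map_zero] at hϖ; exact WithZero.coe_ne_zero hϖ.symm
  have hϖ1 : Valued.v ϖ ≤ 1 := by rw [hϖ, ← WithZero.exp_zero, WithZero.exp_le_exp]; norm_num
  have hvϖ0 : Valued.v ϖ ≠ 0 := (Valuation.ne_zero_iff _).2 hϖ0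
  set d₁ : K := ((ϖ * σ ϖ) ^ j)⁻¹ with hd₁
  have hvd₁p : Valued.v d₁ * Valued.v (ϖ ^ (2 * j)) = 1 := by
    rw [hd₁, map_inv₀, map_pow, map_mul, hvσ, ← sq, map_pow, ← pow_mul]
    exact inv_mul_cancel₀ (pow_ne_zero _ hvϖ0)
  have hG : formCongr σ (Matrix.GeneralLinearGroup.mkOfDetNeZero _ (det_axis3_ne_zero hϖ0 x (2 * j))) (Matrix.diagonal ![-(σ x * d₁ * x), d₁, 1]) =
      !![0, σ x * d₁ * ϖ ^ (2 * j), 0; σ (ϖ ^ (2 * j)) * d₁ * x, σ (ϖ ^ (2 * j)) * d₁ * ϖ ^ (2 * j), 0; 0, 0, 1] := by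
    rw [formCongr_hnf_diagonal σ _ x 0 0 (ϖ ^ (2 * j)) 1 _ rfl]
    ext i k
    fin_cases i <;> fin_cases k <;> simp
  refine isVertexLattice_zero_of_gram_eq_block₃ hϖ1 _ hG ?_ ?_ ?_ (map_one _)
  · rw [map_mul, map_mul, hvσ, hx, one_mul, hvd₁p]
  · rw [map_mul, map_mul, hvσ, hx, mul_one, mul_comm, hvd₁p]
  · rw [map_mul, map_mul, hvσ, mul_comm (Valued.v (ϖ ^ (2 * j))) (Valued.v d₁), mul_assoc, mul_comm (Valued.v (ϖ ^ (2 * j))),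
      ← mul_assoc, hvd₁p, one_mul, map_pow]
    exact pow_le_one' hϖ1 _

end Valued

end Summit.HodgeConjecture.HodgeConjecture.Cruxes.H413.F0P3cDyRamDiagonalKappaSplitCountEval

end
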